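import Mathlib
import Literature.Analysis.FluidPDE.MVRelativeEnergyPointwiseBounds
import Summits.AtomisticToContinuum.HydrodynamicLimit.Theorems.ImplosionDichotomyDenseExcursionSonicCavityDefs

/-!
# Coefficient bounds of the centre system from the cavity tube
# (crux `DenseExcursion`, line `sonic-cavity-renewal`, brick for `centreContent_of_tube`)

Helper file (`--supports stmt-AtomisticToContinuum-12586`, line lead a2, stub-worker W3 for `centreContent_of_tube`).

Pointwise real-arithmetic bounds for the coefficients `θ, k, A, B, C, D` and `k′/k − 1` of the centre system
(`…SonicCentreContentInnerSystem`: `𝒰′ = (Λθ − 2 + A)𝒰 + (3Λk + B)𝒮`, `𝒮′ = (Λθ + D)𝒮 + (Λk/3 + C)𝒰`) on the inner region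
`ρ = eˣ ≤ 1/50`, in terms of the atoms `w = W(x)`, `w′ = W′(x)`, `σ = S(x)`, `σ′ = S′(x)`, `ρ`, `r` under the hypotheses
supplied by the cavity tube: the pinned window `17307/15625 ≤ r ≤ 89409/80000`, the centre expansion (CavityTube (d))
`|W − (r−1)| ≤ ρ²/10 + 2ρ⁴`, `|W′| ≤ ρ²/5 + 2ρ⁴`, `|(ρS)′| = |ρS + ρS′| ≤ ρ²/5 + 2ρ⁴`, and the envelope (CavityTube (c))
`7/10 ≤ ρS ≤ 1`. Results (`d = (w−1)² − σ²`): `ρ²(−d) ≥ 0.489` (`inner_det_lower`, registered helper), `0 ≤ θ ≤ 1.83ρ²`,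
`ρ ≤ k ≤ 1.44ρ`, `|A| ≤ 4.5ρ²`, `|B| ≤ 2.2ρ³`, `|C| ≤ 0.86ρ`, `|D| ≤ 0.42ρ²`, `|k′/k − 1| ≤ 6.5ρ²`. Only `C = O(ρ)` (main part
`(2/3)(r−2)k`, the differential growth `e^{∓(2−r)ρ/s₀}` of the two acoustic families); everything else is `O(ρ²)`.

Elementary (`nlinarith`/`linarith` on explicit polynomial identities). NOT here: the mode, the energies.
-/

noncomputable section

namespace Summit.AtomisticToContinuum.HydrodynamicLimit.Theorems.SonicCavityRenewal

open Literature.Analysis.FluidPDE.CompressibleEuler (abs_mul_le_of_le)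

/-- **Registered helper `inner_det_lower`.** THE PRINCIPAL DETERMINANT AT THE CENTRE: with `ρ = eˣ ≤ 1/50`, the pinned
window for `r`, `|W − (r−1)| ≤ ρ²/10 + 2ρ⁴` (CavityTube (d)) and `7/10 ≤ ρS` (CavityTube (c)), the determinant
`d = (W−1)² − S²` satisfies `ρ²(−d) = (ρS)² − ρ²(W−1)² ≥ 0.489`. [folklore] -/
theorem inner_det_lower : ∀ {r ρ w σ : ℝ}, 17307 / 15625 ≤ r → r ≤ 89409 / 80000 → 0 < ρ → ρ ≤ 1 / 50 → |w - (r - 1)| ≤ ρ ^ 2 / 10 + 2 * ρ ^ 4 → 7 / 10 ≤ ρ * σ → 489 / 1000 ≤ ρ ^ 2 * (σ ^ 2 - (w - 1) ^ 2) := by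
  intro r ρ w σ hr₁ hr₂ hρ hρ₁ hw hs₁
  have hρ2 : ρ ^ 2 ≤ 1 / 2500 := by nlinarith
  have hρ4 : ρ ^ 4 ≤ 1 / 2500 * ρ ^ 2 := by nlinarith
  obtain ⟨hw₁, hw₂⟩ := abs_le.mp hw
  have h1 : (w - 1) ^ 2 ≤ (893 / 1000) ^ 2 := by
    have : |w - 1| ≤ 893/1000 := abs_le.mpr ⟨by nlinarith, by nlinarith⟩
    nlinarith [abs_nonneg (w-1), sq_abs (w-1)]
  have h2 : (7/10) ^ 2 ≤ (ρ * σ) ^ 2 := by nlinarith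
  nlinarith

/-- The advection coefficient `θ = (W−1)/d` is non-negative and `O(ρ²)`: `0 ≤ θ ≤ 1.83ρ²`. [folklore] -/
theorem inner_theta_bound {r ρ w σ θr : ℝ} (hr₁ : 17307/15625 ≤ r) (hr₂ : r ≤ 89409/80000) (hρ : 0 < ρ) (hρ₁ : ρ ≤ 1/50)
    (hw : |w - (r - 1)| ≤ ρ ^ 2 / 10 + 2 * ρ ^ 4) (hs₁ : 7/10 ≤ ρ * σ)
    (hθ : θr * ((w - 1) ^ 2 - σ ^ 2) = w - 1) : |θr| ≤ 183 / 100 * ρ ^ 2 ∧ 0 ≤ θr := by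
  have hK := inner_det_lower hr₁ hr₂ hρ hρ₁ hw hs₁
  have hρ2 : ρ ^ 2 ≤ 1 / 2500 := by nlinarith
  obtain ⟨hw₁, hw₂⟩ := abs_le.mp hw
  have hneg : w - 1 < 0 := by nlinarith
  have hD : 0 < σ ^ 2 - (w - 1) ^ 2 := by nlinarith
  have hθ' : θr = (1 - w) / (σ ^ 2 - (w - 1) ^ 2) := by
    field_simp
    linarith
  have hθ0 : 0 ≤ θr := by rw [hθ']; exact div_nonneg (by linarith) hD.le
  refine ⟨?_, hθ0⟩
  rw [abs_of_nonneg hθ0, hθ', div_le_iff₀ hD]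
  have h1w : 1 - w ≤ 893/1000 := by nlinarith
  nlinarith

/-- The acoustic coefficient `k = −S/d` (so that `Λk` is the local wavenumber times `ρ`): `ρ ≤ k ≤ 1.44ρ`. [folklore] -/
theorem inner_k_bounds {r ρ w σ kr : ℝ} (hr₁ : 17307/15625 ≤ r) (hr₂ : r ≤ 89409/80000) (hρ : 0 < ρ) (hρ₁ : ρ ≤ 1/50)
    (hw : |w - (r - 1)| ≤ ρ ^ 2 / 10 + 2 * ρ ^ 4) (hs₁ : 7/10 ≤ ρ * σ) (hs₂ : ρ * σ ≤ 1)
    (hk : kr * ((w - 1) ^ 2 - σ ^ 2) = -σ) : ρ ≤ kr ∧ kr ≤ 144 / 100 * ρ := by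
  have hK := inner_det_lower hr₁ hr₂ hρ hρ₁ hw hs₁
  have hρ2 : ρ ^ 2 ≤ 1 / 2500 := by nlinarith
  obtain ⟨hw₁, hw₂⟩ := abs_le.mp hw
  have hD : 0 < σ ^ 2 - (w - 1) ^ 2 := by nlinarith
  have hσ : 0 < σ := by nlinarith
  have hk' : kr = σ / (σ ^ 2 - (w - 1) ^ 2) := by
    field_simp
    linarith
  rw [hk']
  constructor
  · rw [le_div_iff₀ hD]
    have : ρ * σ ^ 2 ≤ σ := by nlinarith
    nlinarith [sq_nonneg (w - 1)]
  · rw [div_le_iff₀ hD]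
    have h1 : (w - 1) ^ 2 ≤ (893 / 1000) ^ 2 := by
      have : |w - 1| ≤ 893/1000 := abs_le.mpr ⟨by nlinarith, by nlinarith⟩
      nlinarith [abs_nonneg (w-1), sq_abs (w-1)]
    -- σ ≤ 1.44 ρ (σ² - (w-1)²);  with s = ρσ ∈ [0.7,1]: s ≤ 1.44 (s² - ρ²(w-1)²)
    have key : ρ * σ ≤ 144 / 100 * ((ρ * σ) ^ 2 - ρ ^ 2 * (w - 1) ^ 2) := by nlinarith
    nlinarith

/-- Division helper: `0 < c ≤ m` and `|X·m| ≤ B` give `|X| ≤ B/c`. [folklore] -/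
theorem abs_le_div_of_abs_mul_le {X m c B : ℝ} (hc : 0 < c) (hcm : c ≤ m) (h : |X * m| ≤ B) : |X| ≤ B / c := by
  rw [le_div_iff₀ hc]
  have hm : 0 < m := hc.trans_le hcm
  rw [abs_mul, abs_of_pos hm] at h
  calc |X| * c ≤ |X| * m := mul_le_mul_of_nonneg_left hcm (abs_nonneg _)
    _ ≤ B := h

/-- The atom bounds on the inner region `ρ ≤ 1/50` in closed numerical form: `|W−1| ≤ 0.893`, `|W−(r−1)| ≤ 0.101ρ²`,
`|W′| ≤ 0.201ρ²`, `|ρS| ≤ 1`, `|ρS + ρS′| ≤ 0.201ρ²`, `ρ² ≤ 1/2500`. [folklore] -/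
theorem inner_atoms {r ρ w w' σ σ' : ℝ} (hr₁ : 17307/15625 ≤ r) (hr₂ : r ≤ 89409/80000) (hρ : 0 < ρ) (hρ₁ : ρ ≤ 1/50)
    (hw : |w - (r - 1)| ≤ ρ ^ 2 / 10 + 2 * ρ ^ 4) (hw' : |w'| ≤ ρ ^ 2 / 5 + 2 * ρ ^ 4)
    (hs₁ : 7/10 ≤ ρ * σ) (hs₂ : ρ * σ ≤ 1) (hds : |ρ * σ + ρ * σ'| ≤ ρ ^ 2 / 5 + 2 * ρ ^ 4) :
    |w - 1| ≤ 893 / 1000 ∧ |w - (r - 1)| ≤ 101 / 1000 * ρ ^ 2 ∧ |w'| ≤ 201 / 1000 * ρ ^ 2 ∧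
      |ρ * σ| ≤ 1 ∧ |ρ * σ + ρ * σ'| ≤ 201 / 1000 * ρ ^ 2 ∧ ρ ^ 2 ≤ 1 / 2500 := by
  have hρ2 : ρ ^ 2 ≤ 1 / 2500 := by nlinarith
  have hρ4 : ρ ^ 4 ≤ 1 / 2500 * ρ ^ 2 := by nlinarith
  obtain ⟨hw₁, hw₂⟩ := abs_le.mp hw
  refine ⟨abs_le.mpr ⟨by nlinarith, by nlinarith⟩, hw.trans (by nlinarith), hw'.trans (by nlinarith),
    abs_le.mpr ⟨by nlinarith, hs₂⟩, hds.trans (by nlinarith), hρ2⟩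

/-- The coefficient `A` (`(A−3)d = −(W−1)(W′+2W−r) + 3S(S′+2S)`): `|A| ≤ 4.5ρ²`. [folklore] -/
theorem inner_A_bound {r ρ w w' σ σ' A : ℝ} (hr₁ : 17307/15625 ≤ r) (hr₂ : r ≤ 89409/80000) (hρ : 0 < ρ) (hρ₁ : ρ ≤ 1/50)
    (hw : |w - (r - 1)| ≤ ρ ^ 2 / 10 + 2 * ρ ^ 4) (hw' : |w'| ≤ ρ ^ 2 / 5 + 2 * ρ ^ 4)
    (hs₁ : 7/10 ≤ ρ * σ) (hs₂ : ρ * σ ≤ 1) (hds : |ρ * σ + ρ * σ'| ≤ ρ ^ 2 / 5 + 2 * ρ ^ 4)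
    (hA : (A - 3) * ((w - 1) ^ 2 - σ ^ 2) = -(w - 1) * (w' + 2 * w - r) + 3 * σ * (σ' + 2 * σ)) :
    |A| ≤ 9 / 2 * ρ ^ 2 := by
  have hK := inner_det_lower hr₁ hr₂ hρ hρ₁ hw hs₁
  obtain ⟨a1, a2, a3, a4, a5, hρ2⟩ := inner_atoms hr₁ hr₂ hρ hρ₁ hw hw' hs₁ hs₂ hds
  have hP : A * (ρ ^ 2 * (σ ^ 2 - (w - 1) ^ 2)) =
      ρ ^ 2 * ((w - 1) * (w' - w + 3 - r)) - 3 * ((ρ * σ) * (ρ * σ + ρ * σ')) := by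
    linear_combination (-(ρ ^ 2)) * hA
  have a6 : |w' - w + 3 - r| ≤ 1786 / 1000 := by
    have e : w' - w + 3 - r = w' - (w - (r - 1)) + (4 - 2 * r) := by ring
    rw [e]
    refine (abs_add_le _ _).trans ((add_le_add (abs_sub _ _) le_rfl).trans ?_)
    rw [abs_of_pos (by linarith : (0:ℝ) < 4 - 2 * r)]
    nlinarith
  have t1 : |ρ ^ 2 * ((w - 1) * (w' - w + 3 - r))| ≤ ρ ^ 2 * (893 / 1000 * (1786 / 1000)) := by
    rw [abs_mul, abs_of_nonneg (sq_nonneg ρ)]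
    exact mul_le_mul_of_nonneg_left (abs_mul_le_of_le a1 a6) (sq_nonneg ρ)
  have t2 : |3 * ((ρ * σ) * (ρ * σ + ρ * σ'))| ≤ 3 * (1 * (201 / 1000 * ρ ^ 2)) := by
    rw [abs_mul, abs_of_pos (by norm_num : (0:ℝ) < 3)]
    exact mul_le_mul_of_nonneg_left (abs_mul_le_of_le a4 a5) (by norm_num)
  have hB : |A * (ρ ^ 2 * (σ ^ 2 - (w - 1) ^ 2))| ≤ 22 / 10 * ρ ^ 2 := by
    rw [hP]
    refine (abs_sub _ _).trans ?_
    nlinarith [t1, t2]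
  have := abs_le_div_of_abs_mul_le (by norm_num : (0:ℝ) < 489/1000) hK hB
  calc |A| ≤ 22 / 10 * ρ ^ 2 / (489 / 1000) := this
    _ = (22 / 10) / (489 / 1000) * ρ ^ 2 := by ring
    _ ≤ 9 / 2 * ρ ^ 2 := mul_le_mul_of_nonneg_right (by norm_num) (sq_nonneg ρ)

/-- The coefficient `B` (`Bd = −(W−1)(3S′+6S) + 3S(W′/3+2W−r)`): `|B| ≤ 2.2ρ³`. [folklore] -/
theorem inner_B_bound {r ρ w w' σ σ' Bc : ℝ} (hr₁ : 17307/15625 ≤ r) (hr₂ : r ≤ 89409/80000) (hρ : 0 < ρ) (hρ₁ : ρ ≤ 1/50)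
    (hw : |w - (r - 1)| ≤ ρ ^ 2 / 10 + 2 * ρ ^ 4) (hw' : |w'| ≤ ρ ^ 2 / 5 + 2 * ρ ^ 4)
    (hs₁ : 7/10 ≤ ρ * σ) (hs₂ : ρ * σ ≤ 1) (hds : |ρ * σ + ρ * σ'| ≤ ρ ^ 2 / 5 + 2 * ρ ^ 4)
    (hB : Bc * ((w - 1) ^ 2 - σ ^ 2) = -(w - 1) * (3 * σ' + 6 * σ) + 3 * σ * (w' / 3 + 2 * w - r)) :
    |Bc| ≤ 11 / 5 * ρ ^ 3 := by
  have hK := inner_det_lower hr₁ hr₂ hρ hρ₁ hw hs₁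
  obtain ⟨a1, a2, a3, a4, a5, hρ2⟩ := inner_atoms hr₁ hr₂ hρ hρ₁ hw hw' hs₁ hs₂ hds
  have hP : Bc * (ρ ^ 2 * (σ ^ 2 - (w - 1) ^ 2) * ρ) =
      ρ ^ 2 * (3 * ((w - 1) * (ρ * σ + ρ * σ')) - (ρ * σ) * w' - 3 * ((w - (r - 1)) * (ρ * σ))) := by
    linear_combination (-(ρ ^ 3)) * hB
  have t1 := abs_mul_le_of_le a1 a5
  have t2 := abs_mul_le_of_le a4 a3
  have t3 := abs_mul_le_of_le a2 a4
  have hin : |3 * ((w - 1) * (ρ * σ + ρ * σ')) - (ρ * σ) * w' - 3 * ((w - (r - 1)) * (ρ * σ))| ≤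
      105 / 100 * ρ ^ 2 := by
    have p1 : |3 * ((w - 1) * (ρ * σ + ρ * σ'))| ≤ 3 * (893 / 1000 * (201 / 1000 * ρ ^ 2)) := by
      rw [abs_mul, abs_of_pos (by norm_num : (0:ℝ) < 3)]
      exact mul_le_mul_of_nonneg_left t1 (by norm_num)
    have p3 : |3 * ((w - (r - 1)) * (ρ * σ))| ≤ 3 * (101 / 1000 * ρ ^ 2 * 1) := by
      rw [abs_mul, abs_of_pos (by norm_num : (0:ℝ) < 3)]
      exact mul_le_mul_of_nonneg_left t3 (by norm_num)
    have := abs_sub (3 * ((w - 1) * (ρ * σ + ρ * σ')) - (ρ * σ) * w') (3 * ((w - (r - 1)) * (ρ * σ)))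
    have := abs_sub (3 * ((w - 1) * (ρ * σ + ρ * σ'))) ((ρ * σ) * w')
    have hρ2p : 0 < ρ ^ 2 := by positivity
    linarith
  have hB' : |Bc * (ρ ^ 2 * (σ ^ 2 - (w - 1) ^ 2) * ρ)| ≤ ρ ^ 2 * (105 / 100 * ρ ^ 2) := by
    rw [hP, abs_mul, abs_of_nonneg (sq_nonneg ρ)]
    exact mul_le_mul_of_nonneg_left hin (sq_nonneg ρ)
  have hm : 489 / 1000 * ρ ≤ ρ ^ 2 * (σ ^ 2 - (w - 1) ^ 2) * ρ := by nlinarith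
  have := abs_le_div_of_abs_mul_le (by positivity : (0:ℝ) < 489/1000 * ρ) hm hB'
  calc |Bc| ≤ ρ ^ 2 * (105 / 100 * ρ ^ 2) / (489 / 1000 * ρ) := this
    _ = (105 / 100) / (489 / 1000) * ρ ^ 3 := by field_simp
    _ ≤ 11 / 5 * ρ ^ 3 := by nlinarith [pow_pos hρ 3]

/-- The coefficient `C` (`Cd = −(W−1)(S′+2S) + (S/3)(W′+2W−r)`), whose main part is `(2/3)(r−2)k`: `|C| ≤ 0.86ρ` — the only
`O(ρ)` remainder of the centre system (the differential growth of the two families). [folklore] -/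
theorem inner_C_bound {r ρ w w' σ σ' Cc kr : ℝ} (hr₁ : 17307/15625 ≤ r) (hr₂ : r ≤ 89409/80000) (hρ : 0 < ρ)
    (hρ₁ : ρ ≤ 1/50)
    (hw : |w - (r - 1)| ≤ ρ ^ 2 / 10 + 2 * ρ ^ 4) (hw' : |w'| ≤ ρ ^ 2 / 5 + 2 * ρ ^ 4)
    (hs₁ : 7/10 ≤ ρ * σ) (hs₂ : ρ * σ ≤ 1) (hds : |ρ * σ + ρ * σ'| ≤ ρ ^ 2 / 5 + 2 * ρ ^ 4)
    (hk : kr * ((w - 1) ^ 2 - σ ^ 2) = -σ)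
    (hC : Cc * ((w - 1) ^ 2 - σ ^ 2) = -(w - 1) * (σ' + 2 * σ) + σ / 3 * (w' + 2 * w - r)) :
    |Cc| ≤ 43 / 50 * ρ := by
  have hK := inner_det_lower hr₁ hr₂ hρ hρ₁ hw hs₁
  obtain ⟨hk₁, hk₂⟩ := inner_k_bounds hr₁ hr₂ hρ hρ₁ hw hs₁ hs₂ hk
  obtain ⟨a1, a2, a3, a4, a5, hρ2⟩ := inner_atoms hr₁ hr₂ hρ hρ₁ hw hw' hs₁ hs₂ hds
  -- the remainder after the main term (2/3)(r-2) kr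
  have hP : (Cc - 2 / 3 * (r - 2) * kr) * (ρ ^ 2 * (σ ^ 2 - (w - 1) ^ 2) * ρ) =
      ρ ^ 2 * ((w - 1) * (ρ * σ + ρ * σ') + (ρ * σ) * ((w - (r - 1)) - w') / 3) := by
    linear_combination (-(ρ ^ 3)) * hC + (2 / 3 * (r - 2) * ρ ^ 3) * hk
  have t1 := abs_mul_le_of_le a1 a5
  have a6 : |(w - (r - 1)) - w'| ≤ 101 / 1000 * ρ ^ 2 + 201 / 1000 * ρ ^ 2 :=
    (abs_sub _ _).trans (add_le_add a2 a3)
  have t2 := abs_mul_le_of_le a4 a6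
  have hin : |(w - 1) * (ρ * σ + ρ * σ') + (ρ * σ) * ((w - (r - 1)) - w') / 3| ≤ 281 / 1000 * ρ ^ 2 := by
    refine (abs_add_le _ _).trans ?_
    rw [abs_div, abs_of_pos (by norm_num : (0:ℝ) < 3)]
    have hρ2p : 0 < ρ ^ 2 := by positivity
    linarith
  have hB' : |(Cc - 2 / 3 * (r - 2) * kr) * (ρ ^ 2 * (σ ^ 2 - (w - 1) ^ 2) * ρ)| ≤
      ρ ^ 2 * (281 / 1000 * ρ ^ 2) := by
    rw [hP, abs_mul, abs_of_nonneg (sq_nonneg ρ)]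
    exact mul_le_mul_of_nonneg_left hin (sq_nonneg ρ)
  have hm : 489 / 1000 * ρ ≤ ρ ^ 2 * (σ ^ 2 - (w - 1) ^ 2) * ρ := by nlinarith
  have h1 := abs_le_div_of_abs_mul_le (by positivity : (0:ℝ) < 489/1000 * ρ) hm hB'
  have h2 : |Cc - 2 / 3 * (r - 2) * kr| ≤ 3 / 5 * ρ ^ 3 := by
    calc |Cc - 2 / 3 * (r - 2) * kr| ≤ ρ ^ 2 * (281 / 1000 * ρ ^ 2) / (489 / 1000 * ρ) := h1
      _ = (281 / 1000) / (489 / 1000) * ρ ^ 3 := by field_simp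
      _ ≤ 3 / 5 * ρ ^ 3 := by nlinarith [pow_pos hρ 3]
  have h3 : |2 / 3 * (r - 2) * kr| ≤ 2 / 3 * (8924 / 10000) * (144 / 100 * ρ) := by
    have hkr0 : 0 ≤ kr := by linarith
    have e : |2 / 3 * (r - 2) * kr| = 2 / 3 * (2 - r) * kr := by
      rw [abs_mul, abs_mul, abs_of_pos (by norm_num : (0:ℝ) < 2/3), abs_of_nonpos (by linarith : r - 2 ≤ 0),
        abs_of_nonneg hkr0]
      ring
    rw [e]
    have h5 : 2 - r ≤ 8924 / 10000 := by linarith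
    have h6 : (2 - r) * kr ≤ 8924 / 10000 * (144 / 100 * ρ) := mul_le_mul h5 hk₂ hkr0 (by norm_num)
    linarith
  have h4 := abs_sub_abs_le_abs_sub Cc (2 / 3 * (r - 2) * kr)
  have hρ3 : ρ ^ 3 ≤ 1 / 2500 * ρ := by
    have h := mul_le_mul_of_nonneg_left hρ2 hρ.le
    calc ρ ^ 3 = ρ * ρ ^ 2 := by ring
      _ ≤ ρ * (1 / 2500) := h
      _ = 1 / 2500 * ρ := by ring
  linarith

/-- The coefficient `D` (`(D−1)d = −(W−1)(W′/3+2W−r) + (S/3)(3S′+6S)`): `|D| ≤ 0.42ρ²`. [folklore] -/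
theorem inner_D_bound {r ρ w w' σ σ' Dc : ℝ} (hr₁ : 17307/15625 ≤ r) (hr₂ : r ≤ 89409/80000) (hρ : 0 < ρ) (hρ₁ : ρ ≤ 1/50)
    (hw : |w - (r - 1)| ≤ ρ ^ 2 / 10 + 2 * ρ ^ 4) (hw' : |w'| ≤ ρ ^ 2 / 5 + 2 * ρ ^ 4)
    (hs₁ : 7/10 ≤ ρ * σ) (hs₂ : ρ * σ ≤ 1) (hds : |ρ * σ + ρ * σ'| ≤ ρ ^ 2 / 5 + 2 * ρ ^ 4)
    (hD : (Dc - 1) * ((w - 1) ^ 2 - σ ^ 2) = -(w - 1) * (w' / 3 + 2 * w - r) + σ / 3 * (3 * σ' + 6 * σ)) :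
    |Dc| ≤ 21 / 50 * ρ ^ 2 := by
  have hK := inner_det_lower hr₁ hr₂ hρ hρ₁ hw hs₁
  obtain ⟨a1, a2, a3, a4, a5, hρ2⟩ := inner_atoms hr₁ hr₂ hρ hρ₁ hw hw' hs₁ hs₂ hds
  have hP : Dc * (ρ ^ 2 * (σ ^ 2 - (w - 1) ^ 2)) =
      ρ ^ 2 * ((w - 1) * (w' / 3 + (w - (r - 1)))) - (ρ * σ) * (ρ * σ + ρ * σ') := by
    linear_combination (-(ρ ^ 2)) * hD
  have a6 : |w' / 3 + (w - (r - 1))| ≤ 201 / 1000 * ρ ^ 2 / 3 + 101 / 1000 * ρ ^ 2 := by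
    refine (abs_add_le _ _).trans (add_le_add ?_ a2)
    rw [abs_div, abs_of_pos (by norm_num : (0:ℝ) < 3)]
    linarith
  have t1 := abs_mul_le_of_le a1 a6
  have t2 := abs_mul_le_of_le a4 a5
  have hB : |Dc * (ρ ^ 2 * (σ ^ 2 - (w - 1) ^ 2))| ≤ 2011 / 10000 * ρ ^ 2 := by
    rw [hP]
    refine (abs_sub _ _).trans ?_
    rw [abs_mul, abs_of_nonneg (sq_nonneg ρ)]
    have hρ2p : 0 < ρ ^ 2 := by positivity
    nlinarith
  have := abs_le_div_of_abs_mul_le (by norm_num : (0:ℝ) < 489/1000) hK hB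
  calc |Dc| ≤ 2011 / 10000 * ρ ^ 2 / (489 / 1000) := this
    _ = (2011 / 10000) / (489 / 1000) * ρ ^ 2 := by ring
    _ ≤ 21 / 50 * ρ ^ 2 := mul_le_mul_of_nonneg_right (by norm_num) (sq_nonneg ρ)

/-- The logarithmic derivative of `k = −S/d` minus one: with `k′d² = −S′d + S(2(W−1)W′ − 2SS′)`,
`|k′/k − 1| ≤ 6.5ρ²`. [folklore] -/
theorem inner_gk_bound {r ρ w w' σ σ' kr kr' : ℝ} (hr₁ : 17307/15625 ≤ r) (hr₂ : r ≤ 89409/80000) (hρ : 0 < ρ)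
    (hρ₁ : ρ ≤ 1/50)
    (hw : |w - (r - 1)| ≤ ρ ^ 2 / 10 + 2 * ρ ^ 4) (hw' : |w'| ≤ ρ ^ 2 / 5 + 2 * ρ ^ 4)
    (hs₁ : 7/10 ≤ ρ * σ) (hs₂ : ρ * σ ≤ 1) (hds : |ρ * σ + ρ * σ'| ≤ ρ ^ 2 / 5 + 2 * ρ ^ 4)
    (hk : kr * ((w - 1) ^ 2 - σ ^ 2) = -σ)
    (hk' : kr' * ((w - 1) ^ 2 - σ ^ 2) ^ 2 =
      -σ' * ((w - 1) ^ 2 - σ ^ 2) + σ * (2 * (w - 1) * w' - 2 * σ * σ')) :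
    |kr' / kr - 1| ≤ 13 / 2 * ρ ^ 2 := by
  have hK := inner_det_lower hr₁ hr₂ hρ hρ₁ hw hs₁
  obtain ⟨a1, a2, a3, a4, a5, hρ2⟩ := inner_atoms hr₁ hr₂ hρ hρ₁ hw hw' hs₁ hs₂ hds
  have hD : 0 < σ ^ 2 - (w - 1) ^ 2 := by nlinarith
  have hσ : 0 < σ := by nlinarith
  have hkr : kr = σ / (σ ^ 2 - (w - 1) ^ 2) := by
    field_simp
    linarith
  have hkr0 : 0 < kr := by rw [hkr]; positivity
  -- the polynomial identity for gk · (ρ²D) · (ρσ)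
  have hkr' : kr' = (-σ' * ((w - 1) ^ 2 - σ ^ 2) + σ * (2 * (w - 1) * w' - 2 * σ * σ')) /
      ((w - 1) ^ 2 - σ ^ 2) ^ 2 := by
    have hd2 : ((w - 1) ^ 2 - σ ^ 2) ^ 2 ≠ 0 := pow_ne_zero 2 (by linarith)
    rw [eq_div_iff hd2]
    exact hk'
  have hP : (kr' / kr - 1) * ((ρ ^ 2 * (σ ^ 2 - (w - 1) ^ 2)) * (ρ * σ)) =
      (ρ * σ + ρ * σ') * (ρ ^ 2 * (σ ^ 2 - (w - 1) ^ 2)) +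
        (ρ * σ) * (2 * (ρ ^ 2 * ((w - 1) * (w' + (w - 1)))) - 2 * ((ρ * σ) * (ρ * σ + ρ * σ'))) := by
    have hd1 : (w - 1) ^ 2 - σ ^ 2 ≠ 0 := by linarith
    rw [hkr, hkr']
    field_simp
    ring
  have hDle : ρ ^ 2 * (σ ^ 2 - (w - 1) ^ 2) ≤ 1 := by nlinarith [sq_nonneg (w - 1)]
  have a6 : |w' + (w - 1)| ≤ 201 / 1000 * ρ ^ 2 + 893 / 1000 := (abs_add_le _ _).trans (add_le_add a3 a1)
  have t1 := abs_mul_le_of_le a1 a6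
  have t2 := abs_mul_le_of_le a4 a5
  have hρ2p : 0 < ρ ^ 2 := by positivity
  have s1 : |(ρ * σ + ρ * σ') * (ρ ^ 2 * (σ ^ 2 - (w - 1) ^ 2))| ≤ 201 / 1000 * ρ ^ 2 * 1 :=
    abs_mul_le_of_le a5 (by rw [abs_of_nonneg (by linarith)]; exact hDle)
  have q1 : |2 * (ρ ^ 2 * ((w - 1) * (w' + (w - 1))))| ≤
      2 * (ρ ^ 2 * (893 / 1000 * (201 / 1000 * ρ ^ 2 + 893 / 1000))) := by
    rw [abs_mul, abs_of_pos (by norm_num : (0:ℝ) < 2), abs_mul, abs_of_nonneg (sq_nonneg ρ)]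
    exact mul_le_mul_of_nonneg_left (mul_le_mul_of_nonneg_left t1 (sq_nonneg ρ)) (by norm_num)
  have q2 : |2 * ((ρ * σ) * (ρ * σ + ρ * σ'))| ≤ 2 * (1 * (201 / 1000 * ρ ^ 2)) := by
    rw [abs_mul, abs_of_pos (by norm_num : (0:ℝ) < 2)]
    exact mul_le_mul_of_nonneg_left t2 (by norm_num)
  have s2 : |2 * (ρ ^ 2 * ((w - 1) * (w' + (w - 1)))) - 2 * ((ρ * σ) * (ρ * σ + ρ * σ'))| ≤ 2 * ρ ^ 2 := by
    refine (abs_sub _ _).trans ?_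
    have hρ4 : ρ ^ 2 * ρ ^ 2 ≤ 1 / 2500 * ρ ^ 2 := mul_le_mul_of_nonneg_right hρ2 (sq_nonneg ρ)
    linarith
  have s3 := abs_mul_le_of_le a4 s2
  have hB : |(kr' / kr - 1) * ((ρ ^ 2 * (σ ^ 2 - (w - 1) ^ 2)) * (ρ * σ))| ≤ 2201 / 1000 * ρ ^ 2 := by
    rw [hP]
    refine (abs_add_le _ _).trans ?_
    linarith
  have hm : 489 / 1000 * (7 / 10) ≤ (ρ ^ 2 * (σ ^ 2 - (w - 1) ^ 2)) * (ρ * σ) :=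
    mul_le_mul hK hs₁ (by norm_num) (by linarith)
  have := abs_le_div_of_abs_mul_le (by norm_num : (0:ℝ) < 489 / 1000 * (7 / 10)) hm hB
  calc |kr' / kr - 1| ≤ 2201 / 1000 * ρ ^ 2 / (489 / 1000 * (7 / 10)) := this
    _ = (2201 / 1000) / (489 / 1000 * (7 / 10)) * ρ ^ 2 := by ring
    _ ≤ 13 / 2 * ρ ^ 2 := mul_le_mul_of_nonneg_right (by norm_num) (sq_nonneg ρ)

end Summit.AtomisticToContinuum.HydrodynamicLimit.Theorems.SonicCavityRenewal

end
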